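/-
Copyright (c) 2026 the pub-hodgecm-mathlib formalisation cell (harness21).  Prover seat hodgecm-mathlib-LH4-p12 (g4), Track A «(D-RAM) FOUR-FRAME», unit U2H, the census leaf
(ρ2b′-X) `stub_U2H_fixedPointCensus_typeTwo_unit0` — RHO2BX-ORDER v1 organ O-Cone ∘ ★ T2b: the PER-CELL identity `#fibre(B₂, b) = #Sol_{2b}(r)` at `jE r = glueUnit(x₀, b)`.  2026-09-04.
-/
import Summits.HodgeConjecture.HodgeConjecture.Theorems.F0P3cDyRamConeGlueNormTransport   -- ★ p857402 `exists_coneData_of_gen`, `map_glueNorm_eq`; brings ★ (L←), ★ (C)(D), ★ DEFS leaf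
import Literature.NumberTheory.Automorphic.UnitaryLatticeTreeBlockGlueFibreCountPlane         -- ★ p857475 (LH4-p05 (g4)) T2b in plane letters + `dualLatt_sup_span_eq_iff_forall_mem_iff`
import HarnessLib

/-!
# Crux `H413`, line LH4 «(D-RAM) FOUR-FRAME», leaf (ρ2b′-X) — O-Cone ∘ T2b, THE PER-CELL IDENTITY: for a plane lattice `B₂` whose line image `φ(B₂) = x₀𝒪_j` lies in
# `levelSetDep(j, b; lam − jE u)` (`lam ∈ 𝒪_j`), the glue fibre over `(B₂.map ι_W, b)` has `Nat.card Sol_{2b}(r)` members for EVERY `r` with `jE r = glueUnit ρ Θ α (jE ϖ^j) h (jE ϖ) (jE h_W) x₀ b`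

Cell `hodgecm-mathlib` (D-0151), FLOOR 0, crux H413 = `stmt-HodgeConjecture-24833`, unit U2H, leaf (ρ2b′-X) (OPEN-CONFIRMED, T18-55); RHO2BX-ORDER v1 organ **O-Cone** (LH4-p12 (g4)).
THEOREMS ONLY (no `def`, no instance, no notation, no `sorry`); lane `--supports stmt-HodgeConjecture-24833 --as helper` (count-neutral).  WHY: this is the `hfg` clause of ★ p857411
`finsum_coneWParts_eq_sum` DISCHARGED per cell — the `g B₂ = …` half is ★ p857475 `ncard_glueFibre_map_planeMatrix_eq_natCard_normFibre` (LH4-p05 (g4): ★ T2b p857229 in plane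
letters), the `… = f j (φB₂)` half is ★ p857402 (`exists_coneData_of_gen`: the canonical dual generator `w₀ = φ⁻¹(Y⁻¹x₀)` of `B₂` — recovered from `φ(B₂)` by ★
`map_toAddSubgroup_injective` — and `map_glueNorm_eq`: `jE r(w₀) = glueUnit(x₀, b)`), glued by the (G1) iff ★ `dualLatt_sup_span_eq_iff_forall_mem_iff` and the injectivity of `jE`.
So the head-of-organs (LH4-p14 (g4)) ∕ O-Sum instantiates ★ p857411 with `g B₂ := #fibre(B₂.map ι_W, b)` (LH4-p07 (g6)'s (γ) summand) and `f j Λ := Nat.card Sol_{2b}(r_Λ)` for any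
choice of generator `x₀` of `Λ` and any `jE`-preimage `r_Λ` of `glueUnit(x₀, b)`, citing THIS lemma for `hfg`.
* `map_glueUnit_eq_self`, `exists_map_eq_glueUnit` — the glue unit is `ρ`-fixed, hence has a `jE`-preimage `r`.
* `ncard_glueFibre_eq_natCard_normFibre_of_gen` — the identity.
HONEST LABEL: count-neutral; HC_CM is proved only modulo the 7 printed citations (2 remaining named inputs: hLiu418 = `stmt-HodgeConjecture-24832`, h413 = `stmt-HodgeConjecture-24833`) until
rung 0 closes.

## References
* [Kottwitz1986BaseChangeUnits] R. E. Kottwitz, *Base change for unit elements of Hecke algebras*, Compositio Math. 60 (1986), §1 pp. 240–241.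
* [Jacobowitz1962] R. Jacobowitz, *Hermitian forms over local fields*, Amer. J. Math. 84 (1962), §4.
* [BruhatTits1972] F. Bruhat, J. Tits, *Groupes réductifs sur un corps local I*, Publ. Math. IHÉS 41 (1972), §10.
-/

set_option autoImplicit false

noncomputable section

open scoped Valued WithZero Matrix MatrixGroups
open WithZero
open scoped Classical
open Literature.NumberTheory.Automorphic Literature.NumberTheory.Automorphic.HermitianLattice Literature.NumberTheory.Automorphic.UnitaryLatticeTree
open Literature.NumberTheory.Automorphic.EllipticPlaneAsFieldLine
open Literature.NumberTheory.LocalFields.QuadraticOrder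
open Summit.HodgeConjecture.HodgeConjecture.Cruxes.H413.F0P3cDyRamToricCensusDefs

namespace Summit.HodgeConjecture.HodgeConjecture.Cruxes.H413.F0P3cDyRamConeLevelTransport

variable {E M : Type*} [Field E] [Valued E ℤᵐ⁰] [Field M] [Valued M ℤᵐ⁰] {ρ Θ : M →+* M} {α : M}

omit [Valued M ℤᵐ⁰] in
/-- The glue unit is `ρ`-FIXED (`ρ(t + ρt) = t + ρt`, `ρϖE = ϖE`, `ρΘϖE = ΘϖE`, `ρc_U = c_U`). [cite: Jacobowitz1962, §4] -/
theorem map_glueUnit_eq_self (hρρ : ∀ x, ρ (ρ x) = x) (hΘρ : ∀ x, Θ (ρ x) = ρ (Θ x)) (c h x₀ : M) {ϖE cU : M} (hϖE : ρ ϖE = ϖE) (hcU : ρ cU = cU)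
    (a : ℕ) : ρ (glueUnit ρ Θ α c h ϖE cU x₀ a) = glueUnit ρ Θ α c h ϖE cU x₀ a := by
  have hΘϖ : ρ (Θ ϖE) = Θ ϖE := by rw [← hΘρ, hϖE]
  rw [glueUnit_def, map_neg, map_div₀, map_mul, map_pow, map_mul, hϖE, hΘϖ, hcU, map_add, hρρ, add_comm (ρ _)]

omit [Valued E ℤᵐ⁰] [Valued M ℤᵐ⁰] in
/-- Hence the glue unit has a `jE`-preimage: `∃ r : E, jE r = glueUnit …` (for `ϖE = jE ϖ`, `c_U = jE h_W`). [cite: Jacobowitz1962, §4] -/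
theorem exists_map_eq_glueUnit (jE : E →+* M) (hρρ : ∀ x, ρ (ρ x) = x) (hΘρ : ∀ x, Θ (ρ x) = ρ (Θ x)) (hjfix : ∀ z, ρ z = z ↔ ∃ c, jE c = z)
    (c h x₀ : M) (ϖ hW : E) (a : ℕ) : ∃ r : E, jE r = glueUnit ρ Θ α c h (jE ϖ) (jE hW) x₀ a :=
  (hjfix _).1 (map_glueUnit_eq_self hρρ hΘρ c h x₀ ((hjfix _).2 ⟨ϖ, rfl⟩) ((hjfix _).2 ⟨hW, rfl⟩) a)

/-- **THE PER-CELL IDENTITY `#fibre(B₂.map ι_W, b) = Nat.card Sol_{2b}(r)` at `jE r = glueUnit(x₀, b)`.**  Block frame of ★ T2a∕b∕c over `E` (`σ` involutive isometric, `|ϖ| = exp(−1)`,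
`H₂` hermitian with unit determinant, middle entry `h_W` a `σ`-fixed unit, `𝒪_E` a PID) + the line model (`jE, ρ, Θ, α, φ, γ₂, lam, h`, value dictionary, `Θ ∘ jE = jE ∘ σ`); `B₂`
a plane lattice whose image `φ(B₂) = x₀·𝒪_j` carries the `levelSetDep(j, b; lam − jE u)` clauses for the generator `x₀` (integral, primitive, level `b ≥ 1`, depth) and `lam ∈ 𝒪_j`.
[cite: Jacobowitz1962, §4] [cite: Kottwitz1986BaseChangeUnits, §1 pp. 240–241] [cite: BruhatTits1972, §10] -/
theorem ncard_glueFibre_eq_natCard_normFibre_of_gen [IsPrincipalIdealRing 𝒪[E]] (σ : E →+* E) (hσ : ∀ a, σ (σ a) = a) (hvσ : ∀ a, Valued.v (σ a) = Valued.v a)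
    {ϖ : E} (hϖ : Valued.v ϖ = WithZero.exp (-1 : ℤ))
    {H₂ : Matrix (Fin 2) (Fin 2) E} (hH₂ : IsUnit H₂.det) (hH₂σ : (H₂.map σ)ᵀ = H₂) {hW : E} (hhW : Valued.v hW = 1) (hhWσ : σ hW = hW) (jE : E →+* M)
    (hρρ : ∀ x, ρ (ρ x) = x) (hvρ : ∀ x, Valued.v (ρ x) = Valued.v x) (hα : ρ α ≠ α) (hα1 : Valued.v α ≤ 1)
    (hint : ∀ z : M, Valued.v z ≤ 1 → Valued.v ((z - ρ z) / (α - ρ α)) ≤ 1)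
    (hΘΘ : ∀ x, Θ (Θ x) = x) (hΘρ : ∀ x, Θ (ρ x) = ρ (Θ x)) (hvΘ : ∀ x, Valued.v (Θ x) = Valued.v x) (hΘj : ∀ x, Θ (jE x) = jE (σ x))
    (hjv : ∀ c, Valued.v (jE c) ≤ 1 ↔ Valued.v c ≤ 1) (hjfix : ∀ z, ρ z = z ↔ ∃ c, jE c = z)
    (hjpow : ∀ (t : E) (n : ℤ), Valued.v (jE t) = Valued.v (jE ϖ) ^ n ↔ Valued.v t = Valued.v ϖ ^ n)
    (hϖmax : ∀ t : M, ρ t = t → Valued.v t < 1 → Valued.v t ≤ Valued.v (jE ϖ))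
    (φ : (Fin 2 → E) →+ M) (hφs : ∀ (c : E) (x : Fin 2 → E), φ (c • x) = jE c * φ x) (hφi : Function.Injective φ) (hφo : Function.Surjective φ)
    {γ₂ : GL (Fin 2) E} {lam h : M} (hφγ : ∀ x, φ ((γ₂ : Matrix (Fin 2) (Fin 2) E).mulVec x) = lam * φ x) (hlam : Valued.v lam = 1)
    (hΘh : Θ h = h) (hh : h ≠ 0) (hform : ∀ x y, jE (pairing σ H₂ x y) = h * Θ (φ x) * φ y + ρ (h * Θ (φ x) * φ y))
    (u : E) {b : ℕ} (hb : 1 ≤ b) {j : ℕ} {B₂ : Submodule 𝒪[E] (Fin 2 → E)} {x₀ : M} (hx₀ : x₀ ≠ 0)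
    (hΛx : ∀ x, x ∈ B₂.toAddSubgroup.map φ ↔ ∃ z, IsOrd ρ α (jE ϖ ^ j) z ∧ x = x₀ * z) (hyO : IsOrd ρ α (jE ϖ ^ j) (dualGen ρ Θ α (jE ϖ ^ j) h x₀))
    (hyprim : ¬ IsOrd ρ α (jE ϖ ^ j) (dualGen ρ Θ α (jE ϖ ^ j) h x₀ / jE ϖ)) (hylev : Valued.v (dualGen ρ Θ α (jE ϖ ^ j) h x₀) = Valued.v (jE ϖ) ^ b)
    (hdepΛ : ∀ b', (∀ x ∈ B₂.toAddSubgroup.map φ, Valued.v (h * Θ x * b' + ρ (h * Θ x * b')) ≤ 1) → (lam - jE u) * b' ∈ B₂.toAddSubgroup.map φ)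
    (hlamj : IsOrd ρ α (jE ϖ ^ j) lam) {r : E} (hr : jE r = glueUnit ρ Θ α (jE ϖ ^ j) h (jE ϖ) (jE hW) x₀ b) :
    {L : Submodule 𝒪[E] (Fin 3 → E) | IsSelfDualLattice σ ϖ (!![H₂ 0 0, 0, H₂ 0 1; 0, hW, 0; H₂ 1 0, 0, H₂ 1 1] : Matrix (Fin 3) (Fin 3) E) L ∧
        L ⊓ LinearMap.ker ((LinearMap.proj (1 : Fin 3) : (Fin 3 → E) →ₗ[E] E).restrictScalars 𝒪[E]) =
          B₂.map ((Matrix.toLin' (!![1, 0; 0, 0; 0, 1] : Matrix (Fin 3) (Fin 2) E)).restrictScalars 𝒪[E]) ∧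
        ∀ c : E, (Pi.single 1 c : Fin 3 → E) ∈ L ↔ Valued.v c ≤ Valued.v ϖ ^ b}.ncard =
      Nat.card {x : 𝒪[E] ⧸ 𝓂[E] ^ (2 * b) // ∃ u' : 𝒪[E], Ideal.Quotient.mk (𝓂[E] ^ (2 * b)) u' = x ∧
        Valued.v ((u' : E) * σ u' - r) ≤ Valued.v (ϖ ^ (2 * b))} := by
  have hvϖ0 : Valued.v ϖ ≠ 0 := by rw [hϖ]; exact WithZero.exp_ne_zero
  have hϖ0 : ϖ ≠ 0 := fun h0 => by rw [h0, map_zero] at hvϖ0; exact hvϖ0 rfl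
  have hϖ1 : Valued.v ϖ < 1 := by rw [hϖ, ← WithZero.exp_zero, WithZero.exp_lt_exp]; norm_num
  -- the canonical cone data of `Λ = φ(B₂)` and `B' = B₂`
  obtain ⟨B', hB'Λ, ⟨g₂, hB'g⟩, -, w₀, hw₀Y, hG1, -, hw₀, -⟩ := exists_coneData_of_gen σ hϖ0 hϖ1 H₂ jE hρρ hvρ hα hα1 hint hΘΘ hΘρ hvΘ hjv hjfix hjpow hϖmax
    φ hφs hφi hφo hφγ hlam hΘh hh hform u hb hx₀ hΛx hyO hyprim hylev hdepΛ hlamj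
  have hBB : B' = B₂ := map_toAddSubgroup_injective φ hφi hB'Λ
  subst hBB
  -- ★ T2b in plane letters at the canonical dual generator
  have hG1' := (dualLatt_sup_span_eq_iff_forall_mem_iff hvσ H₂ B' w₀).2 hG1
  rw [ncard_glueFibre_map_planeMatrix_eq_natCard_normFibre σ hσ hvσ hϖ hH₂ hH₂σ hhW hhWσ g₂ hB'g hb hG1' hw₀]
  -- the norm datum of the canonical generator IS `r`
  have hr' : -(pairing σ H₂ w₀ w₀) * (ϖ ^ b * σ (ϖ ^ b)) / hW = r :=
    jE.injective (by rw [map_glueNorm_eq σ H₂ jE hΘj φ hform hw₀Y ϖ hW b, hr])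
  rw [hr']

end Summit.HodgeConjecture.HodgeConjecture.Cruxes.H413.F0P3cDyRamConeLevelTransport

end
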